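import Summits.ABC.IUTFork.Joshi.TestThetaLocusSaturationExp
import Summits.ABC.IUTFork.Joshi.TestThetaValuesLocusModel
import HarnessLib

/-!
# TEST addendum: the volume dictionaries `VolumeDictionary` / `PilotTupleVolumeDictionary` of branch E are SATISFIABLE —
# kernel MODELS (Joshi's typed locus over `Q̄_p` ↔ two settings of the cell's naive `p`-adic family); located, not adjudicated

Test-side support file of the abc-iut cell, branch E (rung LADDER-ABC:A2.E; seat abc-iut-E-t3, gen 2), sequel of
`Joshi/TestThetaValuesLocus.lean` (p429558: `VolumeDictionary`, `PilotTupleVolumeDictionary`, `statement_of_volumeDictionary_family` —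
the FILLS-MODULO-Y line of record, Y = `VolumeDictionary`), `Joshi/TestThetaLocusSaturation.lean` (p431044: with the root tower the
dictionary forces `Σ_j logvol(ⁿ˒°𝒰_{j,v_ℚ}) ≥ 0`), `Joshi/TestThetaLocusSaturationExp.lean` (p432781: NO hull-level dictionary to any
member of the exponent census `expSetting p e`) and the carrier MODEL `Joshi/TestThetaValuesLocusModel.lean` (p432971:
`Model.prototypeDatum p` over `Q̄_p = PadicAlgCl p`, `ℓ⋆ = 2`, `ξ = p`, canonical point, root tower). Sources: K. Joshi,
arXiv:2303.01662 v3 (`paper:arxiv-2303.01662`, bib `Joshi2023ATS2Local`), UNREFEREED, rejected by the IUT author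
[Mochizuki2024JoshiReport], accepted by neither side of the dispute (D-0012). FRAMING: locates / conditionally verifies; no abc claim; no
side taken on [IUTchIII] Cor. 3.12 or on any author; typed ≠ proved ≠ endorsed; a model exhibits SATISFIABILITY of typed hypotheses,
nothing more. `S := Cor312Vol.PilotKummerIndRelated` occurs nowhere below.

## What is shown (kernel; gen-0's OPEN (i) «satisfiability witness for VolumeDictionary ∧ RootTower ∧ BridgeHyps»)

1. **The model locus has size exactly `1`** (`Model.size_thetaLocus_eq_one`): `|Θ̃|_B ≤ 1` because the model norms do not depend on
   `ρ` and `|Θ̃|_{B,1} ≤ 1` (Prop. 9.4.1 as typed), `|Θ̃|_B ≥ 1` by the saturation along the root tower (p430929). So a hull-level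
   dictionary (iii) «`|Θ̃|_B = exp Σ_j logvol(ⁿ˒°𝒰_{j,v_ℚ})`» needs a setting whose packet hulls have TOTAL log-volume `0` at the place.
2. **`unitSetting p` — the LOG-SHELL-SATURATED member of the naive family**: abc-iut-w5-d232's `expSetting p (j ↦ 1)` (honest q-datum
   `{(±q)_j}`, q-pilot image `B_1 = q·𝒪`, typed Thm. 3.11 (i)–(iii) context of `naiveFull p`, natural frame `pFrame`) with the Θ-GLUE
   replaced by the CONSTANT glue «every Kummer image of every lgp-object is the log-shell `𝓘 = B_0 = shellPk` of the packet» (the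
   container all Kummer images lie in; NOT computed from the splitting monoid `Ψ_v = {(±q^{j²})_j}` — an UNINTERPRETED Θ-side, said
   plainly). Kernel: possible images `{B_0}`, hull `B_0`, every hull log-volume `0`, `−|log(Θ)| = 0`, `−|log(q)| = −log p`, bridge
   hypotheses, `|log(q)| > 0`, and the typed Corollary 3.12 HOLDS there (strictly).
3. **`VolumeDictionary (Model.prototypeDatum p) (unitSetting p) v_ℚ` HOLDS** (`volumeDictionary_unitSetting`): (i) `ℓ⋆ = 2 = 2`;
   (ii) `qLocal = −log p = log|ξ|_0` (`ξ = p`); (iii) `|Θ̃|_B = 1 = exp 0`. Hence (`volumeDictionary_satisfiable`) the hypotheses of the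
   FILLS-MODULO-Y theorem `statement_of_volumeDictionary_family` — bridge hypotheses, a dictionary at every place, canonical points (and
   the root tower) — are JOINTLY SATISFIABLE, and the theorem FIRES in the model (`statement_of_volumeDictionary_family_fires`): the
   line of record is not vacuous. The label-level companion FAILS at `unitSetting` (`not_pilotTupleVolumeDictionary_unitSetting`:
   `log|[x_j]|_ρ < 0 = logvol(B_0)`).
4. **The label-level dictionary is satisfiable on an HONEST-Θ member**: with the RENORMALISED model datum `Model.prototypeDatum4 p`
   (`q_E := p^{40}`, `ξ := p^4 = p^{ℓ⋆²}`, same carriers / canonical point / root tower) Joshi's exponent law `|[x_j]|_ρ = |ξ|_0^{(j/ℓ⋆)²}`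
   reads `log|[x_j]|_ρ = −j²·log p = logvol(B_{j²})` — the HONESTLY COMPUTED Kummer image of the Θ-pilot in the naive model — and (ii)
   forces the q-exponent `e_j = 4`: `PilotTupleVolumeDictionary (prototypeDatum4 p) c (expSetting p (j ↦ 4)) v_ℚ ρ` HOLDS
   (`pilotTupleVolumeDictionary_expFour`) at w5-d232's census member `e = (4,4)`, where the pins (pΘ)(pq′), the bridge hypotheses and typed
   Thm. 3.11 hold and the typed Corollary HOLDS (`e₁ + e₂ = 8 ≥ 5`); packaged `pilotTupleVolumeDictionary_satisfiable`. (At the pinned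
   countermodel no hull-level dictionary exists, p429558 `not_volumeDictionary_pinnedSetting`; at the honest corner `e ≡ 1` of the census
   the label-level (ii) would read `−log p = −4·log p`.)

LOCATION, not verdict: the dictionaries are OUR READINGS of [J-IIp] §8.7–§9.3 (Y-CONCORDANCE C8); this file shows they are consistent
with the frozen interface and where (log-shell-saturated Θ-hulls for the hull-level form; `ξ`-renormalisation `|ξ|_0 = p^{−ℓ⋆²}` with
q-exponent `ℓ⋆²` for the label-level form), nothing about which setting the intended situation produces. Toy level (one place,
`ℓ⋆ = 2`); standard axioms only. [claim: Joshi2023ATS2Local, status: disputed]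
-/

noncomputable section

open Set

namespace Summit.ABC.IUTFork.Joshi

open Thm311 Cor312 Cor312Vol Cor312Vol.NaiveWitness Cor312Vol.GluedMonoids.Naive Cor312.Checks Cor312.IdentifiedNonVacuity
  Literature.IUT.LogThetaLattice

variable (p : ℕ) [hp : Fact p.Prime]

/-! ## 1. The model locus has size exactly `1`; the renormalised model datum `ξ = p^4` -/

namespace Model

open PadicAlgCl

/-- Local copy: `‖p‖ = p⁻¹` in `Q̄_p`. [folklore] -/
private theorem norm_p'' : ‖(p : PadicAlgCl p)‖ = (p : ℝ)⁻¹ := by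
  rw [← map_natCast (algebraMap ℚ_[p] (PadicAlgCl p)), ← PadicAlgCl.coe_eq]
  show ‖((p : ℚ_[p]) : PadicAlgCl p)‖ = _
  rw [PadicAlgCl.norm_extends, Padic.norm_p]

/-- Local copy: `0 < ‖p‖ < 1`. [folklore] -/
private theorem norm_p_pos_lt_one'' : 0 < ‖(p : PadicAlgCl p)‖ ∧ ‖(p : PadicAlgCl p)‖ < 1 := by
  have h1 : (1 : ℝ) < p := by exact_mod_cast hp.out.one_lt
  rw [norm_p'']
  exact ⟨inv_pos.2 (lt_trans one_pos h1), inv_lt_one_of_one_lt₀ h1⟩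

/-- In the model the tuple sizes do not depend on `ρ` (every norm `|f|_ρ := ‖f(p)‖`). [folklore] -/
theorem tupleSize_rho_indep (ρ : ℝ) (z : Fin (prototypeDatum p).lstar → (PadicAlgCl p → PadicAlgCl p)) :
    (prototypeDatum p).tupleSize ρ z = (prototypeDatum p).tupleSize 1 z := rfl

/-- Hence `|Z|_{B,ρ} = |Z|_{B,1}` in the model. [folklore] -/
theorem sizeAt_rho_indep (Z : Set (Fin (prototypeDatum p).lstar → (PadicAlgCl p → PadicAlgCl p))) (ρ : ℝ) :
    (prototypeDatum p).sizeAt Z ρ = (prototypeDatum p).sizeAt Z 1 := rfl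

/-- `|Θ̃|_B ≤ 1` in the model (Prop. 9.4.1 as typed, `sizeAt_one_thetaLocus_le_one`, at every `ρ`). [folklore] -/
theorem size_thetaLocus_le_one : (prototypeDatum p).size (prototypeDatum p).thetaLocus ≤ 1 :=
  iSup₂_le fun ρ _ => by
    rw [sizeAt_rho_indep]
    exact (prototypeDatum p).sizeAt_one_thetaLocus_le_one

/-- **`|Θ̃|_B = 1` in the model**: `≤ 1` by Prop. 9.4.1, `≥ 1` by the saturation along the root tower (p430929
`RootTower.one_le_size_thetaLocus`). [folklore] -/
theorem size_thetaLocus_eq_one : (prototypeDatum p).size (prototypeDatum p).thetaLocus = 1 :=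
  le_antisymm (size_thetaLocus_le_one p) (rootTower p).one_le_size_thetaLocus

/-- `log|ξ|_0 = −log p` in the model (`ξ = p`). [folklore] -/
theorem log_abs0_xi : Real.log ((prototypeDatum p).abs0 (prototypeDatum p).xi) = -Real.log p := by
  show Real.log (absOne p (p : PadicAlgCl p)) = _
  rw [absOne_apply, log_norm_p]

/-- **The RENORMALISED model prototype datum**: the same period-ring model, `ℓ⋆ = 2`, with `q_E := p^{40}` and `ξ := p^4 = p^{ℓ⋆²}`
(`|ξ|_0 = |q_E|_0^{1/(2ℓ)} = |q_E|_0^{1/10}`). [folklore] -/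
def prototypeDatum4 : PrototypeDatum (PadicAlgCl p) (PadicAlgCl p → PadicAlgCl p) (PadicAlgCl p) (PadicAlgCl p)
    (fun _ => PadicAlgCl p) Unit where
  toPeriodRingDatum := periodRingDatum p
  lstar := 2
  one_le_lstar := by norm_num
  q := (p : PadicAlgCl p) ^ 40
  abs0_q := by
    show 0 < absOne p _ ∧ absOne p _ < 1
    rw [absOne_apply, norm_pow]
    exact ⟨pow_pos (norm_p_pos_lt_one'' p).1 _, pow_lt_one₀ (norm_nonneg _) (norm_p_pos_lt_one'' p).2 (by norm_num)⟩
  xi := (p : PadicAlgCl p) ^ 4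
  abs0_xi := by
    show absOne p ((p : PadicAlgCl p) ^ 4) = (absOne p ((p : PadicAlgCl p) ^ 40)) ^ (1 / (2 * ((2 * 2 + 1 : ℕ) : ℝ)))
    rw [absOne_apply, absOne_apply, norm_pow, norm_pow]
    have h : (1 / (2 * ((2 * 2 + 1 : ℕ) : ℝ))) = ((10 : ℕ) : ℝ)⁻¹ := by norm_num
    rw [h, show ‖(p : PadicAlgCl p)‖ ^ 40 = (‖(p : PadicAlgCl p)‖ ^ 4) ^ 10 by ring,
      Real.pow_rpow_inv_natCast (pow_nonneg (norm_nonneg _) _) (by norm_num)]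

/-- The canonical point of the renormalised datum (`t = p`, `a = p^{1/4}`; the datum does not involve `ξ`). [folklore] -/
def canonicalPoint4 : (prototypeDatum4 p).CanonicalPoint where
  t := p
  t_ne_zero := by exact_mod_cast hp.out.ne_zero
  absF_t_lt_one := by show absOne p _ < 1; rw [absOne_apply]; exact (norm_p_pos_lt_one'' p).2
  scale_pt_t := expo_p p
  a := rootP p 4
  a_pow := by show rootP p 4 ^ (2 ^ 2) = (p : PadicAlgCl p); exact rootP_pow p (by norm_num)

/-- The root tower of the renormalised datum (`t^{1/N} := rootP N`). [folklore] -/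
def rootTower4 : (prototypeDatum4 p).RootTower where
  t := p
  t_ne_zero := by exact_mod_cast hp.out.ne_zero
  absF_t_lt_one := by show absOne p _ < 1; rw [absOne_apply]; exact (norm_p_pos_lt_one'' p).2
  scale_pt_t := expo_p p
  root := rootP p
  root_pow N hN := rootP_pow p hN

/-- `log|ξ|_0 = −4·log p` for the renormalised datum (`ξ = p^4`). [folklore] -/
theorem log_abs0_xi4 : Real.log ((prototypeDatum4 p).abs0 (prototypeDatum4 p).xi) = -(4 * Real.log p) := by
  show Real.log (absOne p ((p : PadicAlgCl p) ^ 4)) = _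
  rw [absOne_apply, norm_pow, Real.log_pow, log_norm_p]
  push_cast
  ring

end Model

/-! ## 2. The log-shell-saturated setting `unitSetting p` -/

/-- The honest q-exponent vector `e ≡ 1` (q-pilot image `B_1 = q·𝒪`; w5-d247's P♯ corner of the census). [folklore] -/
def expOne : toyIndex.LabelStar → ℕ := fun _ => 1

/-- The renormalised q-exponent vector `e ≡ 4 = ℓ⋆²` (q-pilot image `B_4`). [folklore] -/
def expFour : toyIndex.LabelStar → ℕ := fun _ => 4

/-- **`unitSetting p`** — abc-iut-w5-d232's census member `expSetting p (j ↦ 1)` (honest q-datum) with the Θ-GLUE replaced by the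
CONSTANT glue «the `(n,m)`-Kummer image of every lgp-object at every label is the log-shell `𝓘 = B_0` (`naiveData.shellPk`)» — the
LOG-SHELL-SATURATED Θ-side (uninterpreted: not computed from `Ψ_v`). Every other field verbatim. DATA of a toy.
[claim: Mochizuki2012, status: disputed] -/
def unitSetting : Setting (naiveSituation p) :=
  { expSetting p expOne with thetaRegionOf := fun _ _ j vQ => pBall p j vQ 0 }

/-- Every Kummer image of the Θ-pilot object is the log-shell `B_0`. [folklore] -/
theorem unit_thetaRegion (m : ℤ) (j : toyIndex.Label) (vQ : toyIndex.VQ) : (unitSetting p).thetaRegion m j vQ = pBall p j vQ 0 := rfl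

/-- The q-side is that of `expSetting p (j ↦ 1)`. [folklore] -/
theorem unit_qRegion (j : toyIndex.Label) (vQ : toyIndex.VQ) : (unitSetting p).qRegion j vQ = (expSetting p expOne).qRegion j vQ := rfl

/-- The local q-term at every label of `𝔽_l^⋇` is `μ(B_1) = −log p`. [folklore] -/
theorem unit_qLocal_labelSucc (i : Fin toyIndex.lstar) (vQ : toyIndex.VQ) :
    (unitSetting p).qLocal (Setting.labelSucc i) vQ = -Real.log p := by
  show (expSetting p expOne).qLocal (Setting.labelSucc i) vQ = _
  rw [expSetting_qLocal_labelSucc]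
  simp [expOne]

/-- The (Ind3)-enlarged region is `B_0`. [folklore] -/
theorem unit_thetaRegion3 (j : toyIndex.Label) (vQ : toyIndex.VQ) : (unitSetting p).thetaRegion3 j vQ = pBall p j vQ 0 :=
  Set.iUnion_const _

/-- The possible images are the singleton `{B_0}` ((Ind1),(Ind2) fix every ball). [folklore] -/
theorem unit_possibleImages (j : toyIndex.Label) (vQ : toyIndex.VQ) : (unitSetting p).possibleImages j vQ = {pBall p j vQ 0} := by
  ext U
  constructor
  · rintro ⟨Φ, hΦ, rfl⟩
    rw [unit_thetaRegion3, Set.mem_singleton_iff]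
    exact image_pBall_of_mem_closure p hΦ j vQ _
  · rintro rfl
    rw [← unit_thetaRegion3]
    exact (unitSetting p).thetaRegion3_mem_possibleImages j vQ

/-- The hull of the union of the possible images is `B_0` and is defined. [folklore] -/
theorem unit_thetaHull (j : toyIndex.Label) (vQ : toyIndex.VQ) :
    (unitSetting p).thetaHull j vQ = pBall p j vQ 0 ∧ (unitSetting p).HullDefined j vQ := by
  have hU : ⋃₀ (unitSetting p).possibleImages j vQ = pBall p j vQ 0 := by rw [unit_possibleImages, Set.sUnion_singleton]
  refine ⟨?_, ?_⟩
  · unfold Setting.thetaHull; rw [hU]; exact pFrame_hull_pBall p j vQ _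
  · unfold Setting.HullDefined; rw [hU]; exact pFrame_bounded_hasHull p j vQ _

/-- **Every packet hull has log-volume `0`** (`μ(B_0) = 0`). [folklore] -/
theorem unit_hullLogvol (j : toyIndex.Label) (vQ : toyIndex.VQ) :
    ((naiveSituation p).D (unitSetting p).n).logvol j vQ ((unitSetting p).thetaHull j vQ) = 0 := by
  rw [(unit_thetaHull p j vQ).1]
  show pVol p j vQ (pBall p j vQ 0) = 0
  rw [pVol_pBall]
  simp

/-- The local Θ-term is `0`. [folklore] -/
theorem unit_thetaLocal (j : toyIndex.Label) (vQ : toyIndex.VQ) : (unitSetting p).thetaLocal j vQ = ((0 : ℝ) : WithTop ℝ) := by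
  unfold Setting.thetaLocal
  rw [if_pos (unit_thetaHull p j vQ).2]
  show ((pVol p j vQ ((unitSetting p).thetaHull j vQ) : ℝ) : WithTop ℝ) = _
  rw [(unit_thetaHull p j vQ).1, pVol_pBall]
  simp

/-- "`−|log(Θ)|` is finite". [folklore] -/
theorem unit_thetaFinite : (unitSetting p).ThetaFinite :=
  ⟨fun i vQ => by rw [unit_thetaLocal]; exact WithTop.coe_ne_top, fun _ => Set.toFinite _⟩

/-- **`−|log(Θ)| = 0`** (every hull is the log-shell). [folklore] -/
theorem unit_negLogTheta : (unitSetting p).negLogTheta = ((0 : ℝ) : WithTop ℝ) := by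
  rw [(unitSetting p).negLogTheta_eq_of_thetaFinite (unit_thetaFinite p)]
  congr 1
  have h : (fun i : Fin toyIndex.lstar => ∑ᶠ vQ : toyIndex.VQ, ((unitSetting p).thetaLocal (Setting.labelSucc i) vQ).untopD 0) =
      fun _ => 0 := by
    funext i
    simp only [unit_thetaLocal, finsum_unique, WithTop.untopD_coe]
  rw [h]
  unfold processionNormalized
  simp

/-- `−|log(q)| = −log p` (the honest q-side, `e ≡ 1`). [folklore] -/
theorem unit_negLogQ : (unitSetting p).negLogQ = -Real.log p := by
  show (expSetting p expOne).negLogQ = _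
  rw [expSetting_negLogQ]
  unfold esum expOne
  push_cast
  ring

/-- **The typed Corollary 3.12 HOLDS at `unitSetting p`** (`−log p ≤ 0`, strictly). [folklore] -/
theorem unit_statement : (unitSetting p).Statement := by
  unfold Setting.Statement
  rw [unit_negLogTheta, unit_negLogQ]
  refine ⟨WithTop.coe_ne_top, ?_⟩
  rw [WithTop.coe_le_coe]
  have := NaiveWitness.log_p_pos p
  linarith

/-- `|log(q)| > 0`. [folklore] -/
theorem unit_absLogQPos : (unitSetting p).AbsLogQPos := by
  show (unitSetting p).negLogQ < 0
  rw [unit_negLogQ]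
  have := NaiveWitness.log_p_pos p
  linarith

/-- **Every bridge hypothesis holds at `unitSetting p`** (volume clauses as for the census member; possible images are balls). [folklore] -/
theorem unit_bridgeHyps : BridgeHyps (unitSetting p) where
  mono := (expSetting_bridgeHyps p expOne).mono
  image_adm := fun i vQ U hU => ⟨0, by rw [unit_possibleImages, Set.mem_singleton_iff] at hU; exact hU⟩
  image_fin := fun _ => Set.toFinite _
  hul_nonempty := (expSetting_bridgeHyps p expOne).hul_nonempty
  theta_nonempty := fun i vQ => by rw [unit_thetaRegion3]; exact ⟨0, zero_mem_pBall p _ vQ _⟩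
  finite := unit_thetaFinite p

/-! ## 3. The hull-level dictionary HOLDS from the model locus to `unitSetting`; the FILLS-MODULO-Y line fires -/

/-- **`VolumeDictionary (Model.prototypeDatum p) (unitSetting p) v_ℚ` HOLDS**: (i) `ℓ⋆ = 2` on both sides; (ii) `qLocal = −log p =
log|ξ|_0`; (iii) `|Θ̃|_B = 1 = exp(0) = exp Σ_j logvol(ⁿ˒°𝒰_{j,v_ℚ})`. A satisfiability witness for branch E's Y = `VolumeDictionary`,
nothing more. [claim: Joshi2023ATS2Local, status: disputed] -/
theorem volumeDictionary_unitSetting (vQ : toyIndex.VQ) : VolumeDictionary (Model.prototypeDatum p) (unitSetting p) vQ where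
  lstar_eq := rfl
  qLocal_eq i := by rw [unit_qLocal_labelSucc, Model.log_abs0_xi]
  size_eq := by
    rw [Finset.sum_eq_zero fun i _ => unit_hullLogvol p _ vQ, Real.exp_zero, EReal.coe_one]
    exact Model.size_thetaLocus_eq_one p

/-- **The FILLS-MODULO-Y theorem of record FIRES in the model**: `statement_of_volumeDictionary_family` applied to the bridge hypotheses
of `unitSetting p`, the dictionary at every place and the model canonical point yields the typed Corollary there (which indeed holds,
`unit_statement`). The line of record is not vacuous. [claim: Joshi2023ATS2Local, status: disputed] -/
theorem statement_of_volumeDictionary_family_fires : (unitSetting p).Statement :=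
  statement_of_volumeDictionary_family (unit_bridgeHyps p) (fun _ => Model.prototypeDatum p)
    (fun vQ => volumeDictionary_unitSetting p vQ) fun _ => Model.canonicalPoint p

/-- **SATISFIABILITY of the hypotheses of the FILLS-MODULO-Y line** (gen-0 OPEN (i)): there are a situation with typed Thm. 3.11
(i)–(iii), a setting over it with every bridge hypothesis, and a prototype datum with a volume dictionary AT EVERY place, a canonical
point and a root tower — at which the typed Corollary holds, `|log(q)| > 0` and `−|log(Θ)| = 0` (the `2`-adic log-shell-saturated
member and the model locus over `Q̄_2`). [folklore] -/
theorem volumeDictionary_satisfiable :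
    ∃ (T : ThetaIndex) (F : FullSituation T) (P : Cor312.Setting F.toLatticeSituation.toSituation)
      (J : PrototypeDatum (PadicAlgCl 2) (PadicAlgCl 2 → PadicAlgCl 2) (PadicAlgCl 2) (PadicAlgCl 2) (fun _ => PadicAlgCl 2) Unit),
      F.Statement ∧ BridgeHyps P ∧ (∀ vQ, VolumeDictionary J P vQ) ∧ Nonempty J.CanonicalPoint ∧ Nonempty J.RootTower ∧
      P.Statement ∧ P.AbsLogQPos ∧ P.negLogTheta = ((0 : ℝ) : WithTop ℝ) := by
  haveI : Fact (Nat.Prime 2) := ⟨Nat.prime_two⟩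
  exact ⟨toyIndex, naiveFull 2, unitSetting 2, Model.prototypeDatum 2, naiveFull_statement 2, unit_bridgeHyps 2,
    volumeDictionary_unitSetting 2, ⟨Model.canonicalPoint 2⟩, ⟨Model.rootTower 2⟩, unit_statement 2, unit_absLogQPos 2,
    unit_negLogTheta 2⟩

/-- At `unitSetting` the LABEL-level dictionary FAILS for every prototype datum with a canonical point: a Kummer image of log-volume
`log|[x_j]|_ρ = (j/ℓ⋆)²·log|ξ|_0 < 0` cannot be the log-shell `B_0` (log-volume `0`). [claim: Joshi2023ATS2Local, status: disputed] -/
theorem not_pilotTupleVolumeDictionary_unitSetting {F B E0 : Type} [Field F] [CommRing B] [Field E0] {Y : Type} {K : Y → Type}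
    [∀ y, Field (K y)] {G : Type} (J : PrototypeDatum F B E0 Y K G) (c : J.CanonicalPoint) (vQ : toyIndex.VQ) (ρ : ℝ) :
    ¬ PilotTupleVolumeDictionary J c (unitSetting p) vQ ρ := fun D => by
  obtain ⟨m, hm⟩ := D.theta_eq ⟨0, by decide⟩
  rw [unit_thetaRegion] at hm
  have h0 : ((naiveSituation p).D (unitSetting p).n).logvol (Setting.labelSucc ⟨0, by decide⟩) vQ
      (pBall p (Setting.labelSucc ⟨0, by decide⟩) vQ 0) = 0 := by
    show pVol p _ vQ (pBall p _ vQ 0) = 0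
    rw [pVol_pBall]
    simp
  rw [h0, c.norm_pilotTuple D.rho_mem.1 D.rho_mem.2, Real.log_rpow J.abs0_xi_pos] at hm
  have hneg : Real.log (J.abs0 J.xi) < 0 := Real.log_neg J.abs0_xi_pos J.abs0_xi_lt_one
  have hl : (0 : ℝ) < (J.lstar : ℝ) := by exact_mod_cast lt_of_lt_of_le Nat.one_pos J.one_le_lstar
  have hw : 0 < (((((Fin.cast D.lstar_eq ⟨0, by decide⟩ : Fin J.lstar) : ℕ) : ℝ) + 1) / (J.lstar : ℝ)) ^ 2 :=
    pow_pos (div_pos (by positivity) hl) 2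
  nlinarith

/-! ## 4. The label-level dictionary HOLDS from the renormalised model datum to the honest-Θ census member `e ≡ 4` -/

/-- The local q-term of `expSetting p (j ↦ 4)` is `−4·log p` at every label of `𝔽_l^⋇`. [folklore] -/
theorem expFour_qLocal_labelSucc (i : Fin toyIndex.lstar) (vQ : toyIndex.VQ) :
    (expSetting p expFour).qLocal (Setting.labelSucc i) vQ = -(4 * Real.log p) := by
  rw [expSetting_qLocal_labelSucc]
  simp [expFour]

/-- The `(n,m)`-Kummer image of the Θ-pilot object of the census member is the honest `B_{j²}`. [folklore] -/
theorem expFour_thetaRegion (m : ℤ) (j : toyIndex.Label) (vQ : toyIndex.VQ) :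
    (expSetting p expFour).thetaRegion m j vQ = pBall p j vQ (jsq j) := rfl

/-- Its log-volume at `j = i+1` is `−(i+1)²·log p`. [folklore] -/
theorem expFour_thetaRegion_logvol (m : ℤ) (i : Fin toyIndex.lstar) (vQ : toyIndex.VQ) :
    ((naiveSituation p).D (expSetting p expFour).n).logvol (Setting.labelSucc i) vQ
        ((expSetting p expFour).thetaRegion m (Setting.labelSucc i) vQ) = -((((i : ℕ) : ℝ) + 1) ^ 2 * Real.log p) := by
  rw [expFour_thetaRegion]
  show pVol p _ vQ (pBall p _ vQ (jsq (Setting.labelSucc i))) = _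
  rw [pVol_pBall]
  unfold jsq Setting.labelSucc
  simp only [Fin.val_succ]
  push_cast
  ring

/-- **`PilotTupleVolumeDictionary (prototypeDatum4 p) c (expSetting p (j ↦ 4)) v_ℚ ρ` HOLDS** for `ρ ∈ (0,1]`: (ii) `qLocal = −4·log p =
log|ξ|_0` (`ξ = p^4`); (Θ) at `m = 0` (any `m`) `logvol(B_{j²}) = −j²·log p = (j/ℓ⋆)²·log|ξ|_0 = log|[x_j]|_ρ` — Joshi's exponent law on the
HONESTLY COMPUTED Kummer images once `|ξ|_0 = p^{−ℓ⋆²}`. A satisfiability witness, nothing more. [claim: Joshi2023ATS2Local, status: disputed] -/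
theorem pilotTupleVolumeDictionary_expFour (vQ : toyIndex.VQ) {ρ : ℝ} (hρ : 0 < ρ) (hρ1 : ρ ≤ 1) :
    PilotTupleVolumeDictionary (Model.prototypeDatum4 p) (Model.canonicalPoint4 p) (expSetting p expFour) vQ ρ where
  rho_mem := ⟨hρ, hρ1⟩
  lstar_eq := rfl
  qLocal_eq i := by rw [expFour_qLocal_labelSucc, Model.log_abs0_xi4]
  theta_eq i := by
    refine ⟨0, ?_⟩
    rw [expFour_thetaRegion_logvol, (Model.canonicalPoint4 p).norm_pilotTuple hρ hρ1,
      Real.log_rpow (Model.prototypeDatum4 p).abs0_xi_pos, Model.log_abs0_xi4]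
    have hl : ((Model.prototypeDatum4 p).lstar : ℝ) = 2 := by norm_num [Model.prototypeDatum4]
    rw [hl]
    simp only [Fin.val_cast]
    ring

/-- At that member: typed Thm. 3.11 (i)–(iii) (`naiveFull`), the pins (pΘ)(pq′) for the honest operator `ballOfMonoid`, every bridge
hypothesis, `|log(q)| > 0`, and the typed Corollary 3.12 HOLDS (`e₁ + e₂ = 8 ≥ 5`). [folklore] -/
theorem expFour_profile :
    (naiveFull p).Statement ∧ BridgeHyps (expSetting p expFour) ∧ (expSetting p expFour).Statement ∧
      (expSetting p expFour).AbsLogQPos ∧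
      PinnedRegions (naiveFull p).toLatticeSituation (expSetting p expFour) (ballOfMonoid p) fun v _ => qDatumExp p expFour v :=
  ⟨naiveFull_statement p, expSetting_bridgeHyps p expFour, (expSetting_statement_iff p expFour).2 (by decide),
    expSetting_absLogQPos p expFour (by decide), expSetting_pinnedRegions p expFour⟩

/-- **SATISFIABILITY of the label-level dictionary on an honest-Θ setting**: over `Q̄_2`, the renormalised model datum with its canonical
point and root tower, and the `2`-adic census member `e ≡ 4` — typed Thm. 3.11, pins, bridge hypotheses, `|log(q)| > 0`, the typed
Corollary, and `PilotTupleVolumeDictionary` at every place (at `ρ = 1`). [folklore] -/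
theorem pilotTupleVolumeDictionary_satisfiable :
    ∃ (T : ThetaIndex) (F : FullSituation T) (P : Cor312.Setting F.toLatticeSituation.toSituation)
      (J : PrototypeDatum (PadicAlgCl 2) (PadicAlgCl 2 → PadicAlgCl 2) (PadicAlgCl 2) (PadicAlgCl 2) (fun _ => PadicAlgCl 2) Unit)
      (c : J.CanonicalPoint),
      F.Statement ∧ BridgeHyps P ∧ P.Statement ∧ P.AbsLogQPos ∧ Nonempty J.RootTower ∧
      ∀ vQ, PilotTupleVolumeDictionary J c P vQ 1 := by
  haveI : Fact (Nat.Prime 2) := ⟨Nat.prime_two⟩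
  exact ⟨toyIndex, naiveFull 2, expSetting 2 expFour, Model.prototypeDatum4 2, Model.canonicalPoint4 2, naiveFull_statement 2,
    expSetting_bridgeHyps 2 expFour, (expSetting_statement_iff 2 expFour).2 (by decide), expSetting_absLogQPos 2 expFour (by decide),
    ⟨Model.rootTower4 2⟩, fun vQ => pilotTupleVolumeDictionary_expFour 2 vQ one_pos le_rfl⟩

/-- The two dictionaries are realised at DIFFERENT members (for the record): no hull-level dictionary to any census member `expSetting p e`
(p432781, root tower), no label-level dictionary to `unitSetting` (above). [claim: Joshi2023ATS2Local, status: disputed] -/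
theorem dictionaries_separate (e : toyIndex.LabelStar → ℕ) (vQ : toyIndex.VQ) (ρ : ℝ) :
    ¬ VolumeDictionary (Model.prototypeDatum4 p) (expSetting p e) vQ ∧
      ¬ PilotTupleVolumeDictionary (Model.prototypeDatum p) (Model.canonicalPoint p) (unitSetting p) vQ ρ :=
  ⟨not_volumeDictionary_expSetting p (Model.prototypeDatum4 p) (Model.rootTower4 p) e vQ,
    not_pilotTupleVolumeDictionary_unitSetting p (Model.prototypeDatum p) (Model.canonicalPoint p) vQ ρ⟩

end Summit.ABC.IUTFork.Joshi

end
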